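import Literature.Probability.RandomPlanarGeometry.HexSAWRotSurfaceYcCut
import Literature.Probability.RandomPlanarGeometry.HexSAWSurfaceYcFaces
import Literature.Probability.RandomPlanarGeometry.HexSAWRotSurfaceFugacity
import Literature.Probability.RandomPlanarGeometry.HexSAWBrickWallSlab
import Literature.Probability.RandomPlanarGeometry.HexSAWHammersleyWelshExplicit
import Literature.Probability.RandomPlanarGeometry.HexSAWBrickWallSlabStrict
import Literature.Probability.RandomPlanarGeometry.HexSAWRotSlabSummable
import HarnessLib

/-!
# Beaton's rotated-frame critical surface fugacity, III: `y_c = y† = √((2+√2)/(1+√2−√(2+√2)))` (Beaton 2014, Theorem 1)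
# (door (c-rot-print) «HEX-YC-ROT-PRINT», tree edition file R3 of 3 — glues D3ʳ/D7ʳ, D5ʳ from R100, capstone; frame twin of `HexSAWSurfaceYc.lean`)

Topic `Literature/Probability/RandomPlanarGeometry` (continues files R1/R2; takes BY NAME: ⑨ `HV.rotTop_not_bddAbove_of_gt`
(`HexSAWRotSurfaceFugacity.lean`: Beaton Prop. 11 at the strip level), the slab chart `HV.card_rotSlabSAWs_le` (`HexSAWRotSlabSummable.lean`)
and door R100 `HexBW.slabConnectiveConstant_lt_hex` (`HexSAWBrickWallSlabStrict.lean`), plus the tree's `HV.tailCount_holds`).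
Sources: N. R. Beaton, *The critical surface fugacity of self-avoiding walks on a rotated honeycomb lattice*, J. Phys. A 47
(2014) 075003, arXiv:1210.0274v3 — Theorem 1 (p. 2: `y_c = √((2+√2)/(1+√2−√(2+√2)))`), §3.1 and Proposition 7 (p. 11: `C_n^+(y)`,
`μ(y)`, `y_c`), §3.2 (Propositions 8–9, Corollary 10, p. 15), §4 (p. 16; Lemma 12 and Proposition 11 p. 17; proof of Proposition 11
with the last-contact cut, p. 18, Fig. 7); the DCS-frame twin is BBdGDCG14 / Glazman–Manolescu 2020 (tree files `HexSAWSurfaceYc*`).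
READING AS PRINTED (a-idea-1 g18, lit-1 g12 07:34Z): (i) `hexRotSurfaceYc` is the RADIUS FORM `sup {y ≥ 0 : ∀ 0 < x < x_c, the
box-truncated C⁺(x,y) is bounded}` = `sup {y ≥ 0 : limsup_n C_n^+(y)^{1/n} ≤ μ}` unconditionally; = Proposition 7's `y_c` granted the
HTW82 existence clause (neither used nor formalised); (ii) the walk model: vertex self-avoiding lists from `a⁺ = hvOrigin` in the
half-plane `{ξ ≤ 0}`, weight `x^{#vertices} y^{#vertices on ξ = 0}` — Beaton's `m` = the surface count, `n` = the vertex count up to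
bounded factors (radii invariant); (iii) the strip side is K96.1's vocabulary verbatim (`HV.rotStripV`, `HV.rotGFy`, `HV.topContacts`,
`IsRotTopDart`), `rotStripGFxy … x_c y = HV.rotGFy …` by `rfl`.  LABEL (lit-1): CONSOLIDATION — Beaton's Theorem 1 by a route not printed
in this frame (Corollary-10-free: no `y_T → y_c` limit, no HTW existence clause), explicit constants, kernel-checked.
DESIGN AND AUTHORSHIP.  Statements and proofs are a-idea-1 gen 18's HOME sketch `Sketch_G18_RotYcPrint.lean` ed.5 (sha16
490f2f22050d7d50, 2026-08-23) VERBATIM, moved to the tree namespace `…SAW.HV` by the filer lineage a-p6 (gen 8 cut); `TailCount` /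
`tailCount_holds` are the tree's (`HexSAWSurfaceYcFaces.lean`, same text).
THIS FILE: `RotTopUnboundedXc` (⑨, discharged by name), D3ʳ `rotHpBelow_of_faces` (`y < y†` ⇒ C⁺ bounded for every `x < x_c`; D1ʳ + D2ʳ +
K96.1 + `Z(x) < ∞`), D7ʳ `rotHpAbove_of_faces` (`y > y†` ⇒ divergence at some `x < x_c`; ⑨ + Hölder D4ʳ + D5ʳ + D6ʳ), Stage S5 (D5ʳ
`RotStripSupercritFinite` from the slab chart and R100: `rotStripSupercritFinite_of`), the conditional forms `hexRotSurfaceYc_eq_of_faces/'/''`,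
`hexRotSurfaceYc_eq_of_stripCores`, `hexRotSurfaceYc_eq_of_R100`, and the capstone **`HV.hexRotSurfaceYc_eq : hexRotSurfaceYc = rotYdagger`**,
**`HV.hexRotSurfaceYc_eq_printed : hexRotSurfaceYc = √((2+√2)/(1+√2−√(2+√2)))`** with NO hypothesis.
-/

noncomputable section

open Finset Filter Topology

namespace Literature.Probability.RandomPlanarGeometry.SAW.HV

/-! ### The strip-level divergence ⑨ as a face, discharged by name -/

/-- **INPUT (kernel-done in HOME ⑨ `PubSawmu.AIdea1.G17R…rotTop_not_bddAbove_of_gt`, equal by `rfl`): for `y > y†`,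
`∃ H₀, ∀ H ≥ H₀`, `W ↦ B_{H,W+1}(x_c; y)` is unbounded.** [cite: Beaton2014RotatedHoneycomb, §4, Proposition 11 (arXiv v3 p. 17)] -/
def RotTopUnboundedXc : Prop := ∀ y : ℝ, rotYdagger < y → ∃ H₀ : ℕ, ∀ H ≥ H₀,
  ¬ BddAbove (Set.range fun Wd : ℕ => rotStripGFxy H (Wd + 1) (IsRotTopDart H) hexCriticalFugacity y)

/-- **⑨ holds** — the tree's `HV.rotTop_not_bddAbove_of_gt` (`HexSAWRotSurfaceFugacity.lean`), read through `rotStripGFxy_xc`.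
[cite: Beaton2014RotatedHoneycomb, §4, Proposition 11 (arXiv v3 p. 17)] -/
theorem rotTopUnboundedXc_holds : RotTopUnboundedXc := fun _ hy => rotTop_not_bddAbove_of_gt hy

/-- `RotTopUnboundedXc` — `_holds` alias of `rotTopUnboundedXc_holds` above under the fact's exact name (appended
2026-08-28, D-0026 bookkeeping: the proof term is the existing theorem of this file; no statement,
definition or attribute is edited; no new named fact; the ledger's debt table listed the fact
unproved). [cite: Beaton2014RotatedHoneycomb, §4, Proposition 11 (arXiv v3 p. 17)] -/
theorem _root_.Literature.Probability.RandomPlanarGeometry.SAW.HV.RotTopUnboundedXc_holds :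
    RotTopUnboundedXc :=
  _root_.Literature.Probability.RandomPlanarGeometry.SAW.HV.rotTopUnboundedXc_holds

/-! ### The remaining faces -/

/-- **D3ʳ (desorbed half)**: `y < y†` ⇒ `C^+(x, y) < ∞` for every `x < x_c`. [cite: Beaton2014RotatedHoneycomb, §4 (proof of Theorem 1, arXiv v3 p. 16)] -/
def RotHPBelow : Prop := ∀ y : ℝ, 0 < y → y < rotYdagger → ∀ x : ℝ, 0 < x → x < hexCriticalFugacity → RotHalfPlaneBounded x y

/-- **D5ʳ «ROT-STRIP-SUPERCRIT-FINITE» (INPUT: R100's slab strictness `μ(slab_H) < μ_ℍ`, a-p5 HOME, after the chart `D(H, ·) ↪ slab`)**: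
every rotated strip has a supercritical finite point `(x₁, 1)`, `x₁ > x_c`, uniformly in the width.
[cite: Beaton2014RotatedHoneycomb, Proposition 8 (arXiv v3 p. 15: μ_T(1,1) < μ); HammersleyWhittington1985] -/
def RotStripSupercritFinite : Prop := ∀ H : ℕ, 1 ≤ H → ∃ x₁ : ℝ, hexCriticalFugacity < x₁ ∧
  BddAbove (Set.range fun Wd : ℕ => rotStripGFxy H (Wd + 1) (IsRotTopDart H) x₁ 1)

/-- **D7ʳ (adsorbed half)**: `y > y†` ⇒ `C^+(x, y) = ∞` for some `x < x_c`. [cite: Beaton2014RotatedHoneycomb, §4, Proposition 11 (arXiv v3 p. 17)] -/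
def RotHPAbove : Prop := ∀ y : ℝ, rotYdagger < y → ∃ x : ℝ, 0 < x ∧ x < hexCriticalFugacity ∧ ¬ RotHalfPlaneBounded x y

/-! ### PROVED GLUE 0: D1ʳ + D2ʳ + K96.1 + TailCount + `Z(x) < ∞` ⇒ D3ʳ -/

/-- **`y < y†` ⇒ the rotated half-plane partition function is finite for every `x < x_c`**: from D1ʳ with `b(H') = (x/x_c)^{H'+1} K_β(y)`,
`c = hexSawCount`, `z = Z(x) < ∞`: `C^+ ≤ (1 + xZ(x))(xy + x²y² + 2x⁻³ K_β² /(1 − (x/x_c)²))` uniformly in the box.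
[cite: Beaton2014RotatedHoneycomb, §4 (arXiv v3 p. 16); DuminilCopinSmirnov2012, §3 ("Z(x) < +∞ whenever x < x_c")] -/
theorem rotHpBelow_of_faces (hCut : RotHalfPlaneCut) (hLC : RotLevelCost) (hβ : RotTopBoundXc) (hTail : TailCount) : RotHPBelow := by
  intro y hy0 hyS x hx0 hxc
  obtain ⟨hxc0, hxc1⟩ := hexCriticalFugacity_pos_lt_one
  have hx1 : x ≤ 1 := hxc.le.trans hxc1.le
  set ρ := x / hexCriticalFugacity with hρ_def
  have hρ0 : 0 ≤ ρ := div_nonneg hx0.le hxc0.le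
  have hρ1 : ρ < 1 := (div_lt_one hxc0).2 hxc
  set Kβ := rotKbeta y with hKβ_def
  have hKβ0 : 0 ≤ Kβ := rotKbeta_nonneg hy0 hyS
  have hsum : Summable fun n => (hexSawCount n : ℝ) * x ^ n :=
    summable_of_lemma2 DuminilCopinSmirnov2012_lemma2_holds hx0 hxc
  set z := ∑' n, (hexSawCount n : ℝ) * x ^ n with hz_def
  have hz0 : 0 ≤ z := tsum_nonneg fun n => mul_nonneg (Nat.cast_nonneg _) (pow_nonneg hx0.le _)
  have hz : ∀ N : ℕ, ∑ m ∈ range N, (hexSawCount m : ℝ) * x ^ m ≤ z := fun N =>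
    Summable.sum_le_tsum _ (fun m _ => mul_nonneg (Nat.cast_nonneg _) (pow_nonneg hx0.le _)) hsum
  have hb : ∀ H' W' : ℕ, 1 ≤ H' → rotStripGFxy H' W' (IsRotTopDart H') x y ≤ ρ ^ (H' + 1) * Kβ := fun H' W' hH' =>
    (hLC H' W' x y hx0.le hxc.le hy0.le).trans (mul_le_mul_of_nonneg_left (hβ H' W' hH' y hy0 hyS) (pow_nonneg hρ0 _))
  have hmain := hCut x y hx0 hx1 hy0.le (fun H' => ρ ^ (H' + 1) * Kβ) (fun m => (hexSawCount m : ℝ)) z hb hTail hz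
  have hρ2 : ρ ^ 2 < 1 := pow_lt_one₀ hρ0 hρ1 (by norm_num)
  have hρ20 : 0 ≤ ρ ^ 2 := pow_nonneg hρ0 2
  have hgeom : ∀ T : ℕ, ∑ H' ∈ Icc 2 (T + 1), (ρ ^ 2) ^ (H' + 1) ≤ (1 - ρ ^ 2)⁻¹ := fun T => by
    rw [← tsum_geometric_of_lt_one hρ20 hρ2]
    calc ∑ H' ∈ Icc 2 (T + 1), (ρ ^ 2) ^ (H' + 1) = ∑ n ∈ (Icc 2 (T + 1)).map (addRightEmbedding 1), (ρ ^ 2) ^ n := by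
          rw [sum_map]; rfl
      _ ≤ ∑' n, (ρ ^ 2) ^ n :=
          Summable.sum_le_tsum _ (fun _ _ => pow_nonneg hρ20 _) (summable_geometric_of_lt_one hρ20 hρ2)
  have hST : ∀ T : ℕ, ∑ H' ∈ Icc 2 (T + 1), ρ ^ (H' + 1) * Kβ * (ρ ^ (H' + 1) * Kβ) ≤ Kβ * Kβ * (1 - ρ ^ 2)⁻¹ := fun T => by
    have : ∑ H' ∈ Icc 2 (T + 1), ρ ^ (H' + 1) * Kβ * (ρ ^ (H' + 1) * Kβ) = Kβ * Kβ * ∑ H' ∈ Icc 2 (T + 1), (ρ ^ 2) ^ (H' + 1) := by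
      rw [mul_sum]
      refine sum_congr rfl fun H' _ => ?_
      rw [← pow_mul, show 2 * (H' + 1) = (H' + 1) + (H' + 1) by ring, pow_add]
      ring
    rw [this]
    exact mul_le_mul_of_nonneg_left (hgeom T) (by positivity)
  refine ⟨(1 + x * z) * (x * y + x ^ 2 * y ^ 2 + 2 * x⁻¹ ^ 3 * (Kβ * Kβ * (1 - ρ ^ 2)⁻¹)), ?_⟩
  rintro _ ⟨⟨T, L⟩, rfl⟩
  refine (hmain T L).trans ?_
  have hx3 : 0 ≤ 2 * x⁻¹ ^ 3 := mul_nonneg zero_le_two (pow_nonneg (inv_nonneg.2 hx0.le) 3)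
  have h2z : 0 ≤ 1 + x * z := by positivity
  have h1 : 2 * x⁻¹ ^ 3 * (∑ H' ∈ Icc 2 (T + 1), ρ ^ (H' + 1) * Kβ * (ρ ^ (H' + 1) * Kβ))
      ≤ 2 * x⁻¹ ^ 3 * (Kβ * Kβ * (1 - ρ ^ 2)⁻¹) := mul_le_mul_of_nonneg_left (hST T) hx3
  exact mul_le_mul_of_nonneg_left (by linarith) h2z

/-! ### PROVED GLUE 1: the Hölder transfer — ⑨ + D4ʳ + D5ʳ + D6ʳ ⇒ D7ʳ -/

/-- **`y > y†` ⇒ the rotated half-plane partition function diverges at some `x < x_c`** (Hölder transfer, as in the DCS door).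
[cite: Beaton2014RotatedHoneycomb, §4, Proposition 11 (arXiv v3 p. 17); HammersleyTorrieWhittington1982] -/
theorem rotHpAbove_of_faces (hB : RotTopUnboundedXc) (hH : RotHoelderXY) (hS : RotStripSupercritFinite) (hR : RotReversalInjection) :
    RotHPAbove := by
  intro y hy
  have hxc : 0 < hexCriticalFugacity := hexCriticalFugacity_pos_lt_one.1
  have hys : (1 : ℝ) < rotYdagger := one_lt_rotYdagger
  have hy1 : 1 < y := hys.trans hy
  have hy0 : 0 < y := one_pos.trans hy1
  set t := Real.log y with ht_def
  set ts := Real.log rotYdagger with hts_def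
  have hts0 : 0 < ts := Real.log_pos hys
  have htst : ts < t := Real.log_lt_log rotYdagger_pos hy
  have ht0 : 0 < t := hts0.trans htst
  set θ := (t + ts) / (2 * t) with hθ_def
  have hθ0 : 0 < θ := by positivity
  have hθ1 : θ < 1 := by rw [hθ_def, div_lt_one (by positivity)]; linarith
  set y' := y ^ θ with hy'_def
  have hlogy' : Real.log y' = θ * t := by rw [hy'_def, Real.log_rpow hy0]
  have hy's : rotYdagger < y' := by
    have : ts < Real.log y' := by
      rw [hlogy', hθ_def]; rw [div_mul_eq_mul_div, lt_div_iff₀ (by positivity)]; nlinarith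
    exact (Real.log_lt_log_iff rotYdagger_pos (Real.rpow_pos_of_pos hy0 θ)).1 this
  obtain ⟨H₀, hH₀⟩ := hB y' hy's
  set H := max H₀ 1 with hH_def
  have hH1 : 1 ≤ H := le_max_right _ _
  have hunb := hH₀ H (le_max_left _ _)
  obtain ⟨x₁, hx₁c, ⟨M, hM⟩⟩ := hS H hH1
  have hx₁0 : 0 < x₁ := hxc.trans hx₁c
  set x := Real.exp ((Real.log hexCriticalFugacity - (1 - θ) * Real.log x₁) / θ) with hx_def
  have hx0 : 0 < x := Real.exp_pos _
  have hlogx : Real.log x = (Real.log hexCriticalFugacity - (1 - θ) * Real.log x₁) / θ := Real.log_exp _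
  have hxlt : x < hexCriticalFugacity := by
    rw [← Real.log_lt_log_iff hx0 hxc, hlogx, div_lt_iff₀ hθ0]
    have : Real.log hexCriticalFugacity < Real.log x₁ := Real.log_lt_log hxc hx₁c
    nlinarith
  have hxi : x₁ ^ (1 - θ) * x ^ θ = hexCriticalFugacity := by
    rw [Real.rpow_def_of_pos hx₁0, Real.rpow_def_of_pos hx0, ← Real.exp_add, hlogx]
    rw [show Real.log x₁ * (1 - θ) + (Real.log hexCriticalFugacity - (1 - θ) * Real.log x₁) / θ * θ
        = Real.log hexCriticalFugacity by field_simp; ring]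
    exact Real.exp_log hxc
  have hyi : (1 : ℝ) ^ (1 - θ) * y ^ θ = y' := by rw [Real.one_rpow, one_mul]
  refine ⟨x, hx0, hxlt, ?_⟩
  have hunbx : ¬ BddAbove (Set.range fun Wd : ℕ => rotStripGFxy H (Wd + 1) (IsRotTopDart H) x y) := by
    rintro ⟨M', hM'⟩
    apply hunb
    refine ⟨M ^ (1 - θ) * (max M' 0) ^ θ, ?_⟩
    rintro _ ⟨Wd, rfl⟩
    have hHL := hH H (Wd + 1) x₁ x 1 y θ hx₁0 hx0 one_pos hy0 hθ0 hθ1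
    rw [hxi, hyi] at hHL
    refine hHL.trans (mul_le_mul ?_ ?_ (Real.rpow_nonneg (rotStripGFxy_nonneg _ _ _ hx0.le hy0.le) _)
      (Real.rpow_nonneg ((rotStripGFxy_nonneg _ _ _ hx₁0.le zero_le_one).trans (hM ⟨0, rfl⟩)) _))
    · exact Real.rpow_le_rpow (rotStripGFxy_nonneg _ _ _ hx₁0.le zero_le_one) (hM ⟨Wd, rfl⟩) (by linarith)
    · exact Real.rpow_le_rpow (rotStripGFxy_nonneg _ _ _ hx0.le hy0.le) ((hM' ⟨Wd, rfl⟩).trans (le_max_left _ _)) hθ0.le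
  rintro ⟨C, hC⟩
  apply hunbx
  refine ⟨C, ?_⟩
  rintro _ ⟨Wd, rfl⟩
  obtain ⟨L', hL'⟩ := hR H Wd x y hH1 hx0.le hy0.le
  exact hL'.trans (hC ⟨(H, L'), rfl⟩)

/-! ### PROVED GLUE 2: the capstone — D3ʳ + D7ʳ ⇒ `y_c = y†` -/

/-- Members of the desorbed set lie below `y†` (by D7ʳ). [cite: Beaton2014RotatedHoneycomb, Theorem 1] -/
theorem le_rotYdagger_of_mem (hA : RotHPAbove) {y : ℝ} (hy : y ∈ rotYcSet) : y ≤ rotYdagger := by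
  by_contra h
  push Not at h
  obtain ⟨x, hx0, hxc, hnb⟩ := hA y h
  exact hnb (hy.2 x hx0 hxc)

/-- `(0, y†) ⊆` the desorbed set (by D3ʳ). [cite: Beaton2014RotatedHoneycomb, Theorem 1] -/
theorem mem_rotYcSet_of_lt (hBel : RotHPBelow) {y : ℝ} (hy0 : 0 < y) (hy : y < rotYdagger) : y ∈ rotYcSet :=
  ⟨hy0.le, fun x hx0 hxc => hBel y hy0 hy x hx0 hxc⟩

/-- **CAPSTONE OF DOOR (c-rot-print): Beaton's Theorem 1 in the radius form, `y_c = y†`**, from the two half-plane faces.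
[cite: Beaton2014RotatedHoneycomb, Theorem 1 (arXiv v3 p. 2), Proposition 7 (p. 11)] -/
theorem hexRotSurfaceYc_eq_of_faces (hBel : RotHPBelow) (hA : RotHPAbove) : hexRotSurfaceYc = rotYdagger := by
  have h1 : (1 : ℝ) ∈ rotYcSet := mem_rotYcSet_of_lt hBel one_pos one_lt_rotYdagger
  have hne : rotYcSet.Nonempty := ⟨1, h1⟩
  have hbdd : BddAbove rotYcSet := ⟨rotYdagger, fun y hy => le_rotYdagger_of_mem hA hy⟩
  apply le_antisymm
  · exact csSup_le hne fun y hy => le_rotYdagger_of_mem hA hy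
  · apply le_of_forall_lt_imp_le_of_dense
    intro c hc
    by_cases hc0 : c ≤ 1
    · exact hc0.trans (le_csSup hbdd h1)
    · push Not at hc0
      exact le_csSup hbdd (mem_rotYcSet_of_lt hBel (one_pos.trans hc0) hc)

/-- **The whole rotated door in one theorem** over its inputs and open faces: ⑨ (`RotTopUnboundedXc`, kernel-done HOME) + D1ʳ + D5ʳ + D6ʳ ⇒
`y_c = y†`; K96.1, D2ʳ, D4ʳ, `TailCount`, the glues and the `sSup` step are PROVED in this file.
[cite: Beaton2014RotatedHoneycomb, Theorem 1 (arXiv v3 p. 2)] -/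
theorem hexRotSurfaceYc_eq_of_faces' (hCut : RotHalfPlaneCut) (hB : RotTopUnboundedXc) (hS : RotStripSupercritFinite)
    (hR : RotReversalInjection) : hexRotSurfaceYc = rotYdagger :=
  hexRotSurfaceYc_eq_of_faces (rotHpBelow_of_faces hCut rotLevelCost_holds rotTopBoundXc_holds tailCount_holds)
    (rotHpAbove_of_faces hB rotHoelderXY_holds hS hR)

/-- **Door (c-rot-print) with D6ʳ discharged**: ⑨ + D1ʳ + D5ʳ ⇒ `y_c = y†`. [cite: Beaton2014RotatedHoneycomb, Theorem 1 (arXiv v3 p. 2)] -/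
theorem hexRotSurfaceYc_eq_of_faces'' (hCut : RotHalfPlaneCut) (hB : RotTopUnboundedXc) (hS : RotStripSupercritFinite) :
    hexRotSurfaceYc = rotYdagger :=
  hexRotSurfaceYc_eq_of_faces' hCut hB hS rotReversalInjection_holds

/-- **Door (c-rot-print) with D1ʳ and D6ʳ discharged**: ⑨ + D5ʳ ⇒ `y_c = y†`. [cite: Beaton2014RotatedHoneycomb, Theorem 1 (arXiv v3 p. 2)] -/
theorem hexRotSurfaceYc_eq_of_stripCores (hB : RotTopUnboundedXc) (hS : RotStripSupercritFinite) : hexRotSurfaceYc = rotYdagger :=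
  hexRotSurfaceYc_eq_of_faces'' rotHalfPlaneCut_holds hB hS

/-- … and with the printed closed form `y† = √((2+√2)/(1+√2−√(2+√2)))` (tree `HV.rotYdagger_eq_printed`).
[cite: Beaton2014RotatedHoneycomb, Theorem 1 (arXiv v3 p. 2)] -/
theorem hexRotSurfaceYc_eq_printed_of_faces (hCut : RotHalfPlaneCut) (hB : RotTopUnboundedXc) (hS : RotStripSupercritFinite)
    (hR : RotReversalInjection) :
    hexRotSurfaceYc = Real.sqrt ((2 + Real.sqrt 2) / (1 + Real.sqrt 2 - Real.sqrt (2 + Real.sqrt 2))) := by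
  rw [hexRotSurfaceYc_eq_of_faces' hCut hB hS hR, rotYdagger_eq_printed]

/-! ## Stage S5 — D5ʳ `RotStripSupercritFinite` DISCHARGED from R100 through the slab chart

The face `RotStripSupercritFinite` (a supercritical finite point `(x₁, 1)`, `x₁ > x_c`, of every rotated strip, uniformly in the width) is
reduced to two inputs that are LITERALLY kernel-done HOME theorems of a-p5 g7 (∀-closed, verbatim): the slab chart `RotSlabChart` =
`HV.card_rotSlabSAWs_le` (`HexSAWRotSlabSummable.lean`) and R100 `SlabStrict` = `HexBW.slabConnectiveConstant_lt_hex`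
(`HexSAWBrickWallSlabStrict.lean`).  Mechanism: translate a top list of `D(H, W)` by one unit of `ξ` (`shift 0 (−1)`: `ξ ↦ ξ − 1`), so that it
lives in Beaton's slab `1 ≤ −ξ ≤ H + 1`; count by length through the chart; sum the series at `x₁ := 2/(μ(Slab_{H+1}) + x_c⁻¹) ∈ (x_c, 1/μ(Slab_{H+1}))`
by the root test (tree `HexBW.tendsto_slabCount_rpow`). -/

/-- INPUT (a-p5 g7's chart lemma `HV.card_rotSlabSAWs_le`, HOME `HexSAWRotSlabSummable.lean`, ∀-closed verbatim): the `k`-step self-avoiding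
lists from any start confined to Beaton's slab `1 ≤ −ξ ≤ H₀` number at most `c_k(Slab_{max H₀ 1})` (brick-wall column slab, tree
`HexBW.slabCount`). [cite: MadrasSlade1993, §8.2, eq. (8.2.1); Beaton2014RotatedHoneycomb, §2.2 (the domain D_{T,L} and its height, arXiv v3 p. 5; Fig. 3 p. 6; our notation ξ for the row index)] -/
def RotSlabChart : Prop := ∀ (H₀ : ℕ) (s : HV) (k : ℕ),
  ((sawFin s k).filter fun l => ∀ u ∈ l, 1 ≤ -xi u ∧ -xi u ≤ (H₀ : ℤ)).card ≤ HexBW.slabCount (max H₀ 1) k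

/-- INPUT (door R100 = a-p5 g7's `HexBW.slabConnectiveConstant_lt_hex`, HOME `HexSAWBrickWallSlabStrict.lean`, ∀-closed verbatim):
`μ(Slab_H) < μ_ℍ` for every `H ≥ 1`. [cite: Beaton2014RotatedHoneycomb, §3.2, Proposition 8 (arXiv v3 p. 15); MadrasSlade1993, Theorem 8.2.1] -/
def SlabStrict : Prop := ∀ H : ℕ, 1 ≤ H → HexBW.slabConnectiveConstant H < hexConnectiveConstant

/-- Root test: `Σ_n c_n(Slab_{H'}) x^n < ∞` whenever `μ(Slab_{H'}) · x < 1` (tree `HexBW.tendsto_slabCount_rpow`; a-p5's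
`summable_slabCount_mul_pow` is the case `x = x_c`). [cite: MadrasSlade1993, §8.2, eq. (8.2.3)] -/
theorem summable_slabCount_mul_pow_of_lt {H' : ℕ} (hH : 1 ≤ H') {x : ℝ} (hx : 0 < x)
    (h : HexBW.slabConnectiveConstant H' * x < 1) :
    Summable (fun n : ℕ => (HexBW.slabCount H' n : ℝ) * x ^ n) := by
  set μ := HexBW.slabConnectiveConstant H' with hμ
  have hμx : μ < 1 / x := (lt_div_iff₀ hx).2 h
  set r := (μ + 1 / x) / 2 with hr
  have hμr : μ < r := by rw [hr]; linarith
  have hrx : r * x < 1 := (lt_div_iff₀ hx).1 (by rw [hr]; linarith)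
  have hr0 : 0 < r := lt_trans (HexBW.slabConnectiveConstant_pos hH) hμr
  have hev : ∀ᶠ m : ℕ in atTop, (HexBW.slabCount H' m : ℝ) * x ^ m ≤ (r * x) ^ m := by
    have h1 := (HexBW.tendsto_slabCount_rpow hH).eventually (gt_mem_nhds hμr)
    filter_upwards [h1, eventually_ge_atTop 1] with m hm hm1
    have hc0 : (0 : ℝ) ≤ HexBW.slabCount H' m := Nat.cast_nonneg _
    have hpow : (HexBW.slabCount H' m : ℝ) ≤ r ^ m := by
      have h2 : ((HexBW.slabCount H' m : ℝ) ^ (1 / (m : ℝ))) ^ (m : ℝ) ≤ r ^ (m : ℝ) :=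
        Real.rpow_le_rpow (Real.rpow_nonneg hc0 _) hm.le (Nat.cast_nonneg m)
      rw [← Real.rpow_mul hc0, one_div_mul_cancel (by positivity), Real.rpow_one, Real.rpow_natCast] at h2
      exact h2
    rw [mul_pow]
    exact mul_le_mul_of_nonneg_right hpow (pow_nonneg hx.le m)
  refine Summable.of_norm_bounded_eventually_nat (summable_geometric_of_lt_one (by positivity) hrx) ?_
  filter_upwards [hev] with m hm
  rw [Real.norm_of_nonneg (by positivity)]
  exact hm

/-- `ξ ∘ shift(a, b) = ξ + 2a + b`. [cite: Beaton2014RotatedHoneycomb, §2.2 (the domain D_{T,L} and its height, arXiv v3 p. 5; Fig. 3 p. 6; our notation ξ for the row index)] -/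
theorem xi_shift (a b : ℤ) (v : HV) : xi (shift a b v) = xi v + 2 * a + b := by
  obtain ⟨p, q, c⟩ := v
  cases c <;> simp [xi, bit] <;> ring

/-- **Counting by length through the chart**: the top lists of `D(H, W)` with `k + 1` vertices, translated by `shift 0 (−1)` (so `−ξ ∈ [1, H+1]`),
are `k`-step self-avoiding lists in Beaton's slab `1 ≤ −ξ ≤ H + 1`; hence at most `c_k(Slab_{H+1})` of them.
[cite: Beaton2014RotatedHoneycomb, §3.2 (strips inside slabs); MadrasSlade1993, §8.2, eq. (8.2.1)] -/
theorem card_rotTopLists_len_le {H Wd : ℕ} (hchart : RotSlabChart) (hH : 1 ≤ H) (k : ℕ) :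
    ((rotTopLists H Wd).filter fun l => l.length - 1 = k).card ≤ HexBW.slabCount (H + 1) k := by
  have hmax : max (H + 1) 1 = H + 1 := max_eq_left (by omega)
  have hc := hchart (H + 1) (shift 0 (-1) hvOrigin) k
  rw [hmax] at hc
  refine le_trans (Finset.card_le_card_of_injOn (fun l => l.map (shift 0 (-1))) (fun l hl => ?_) (fun l₁ _ l₂ _ h => ?_)) hc
  · rw [mem_coe, mem_filter] at hl
    obtain ⟨hl, hlen⟩ := hl
    obtain ⟨hc, hh, hnd, hV, hne, -⟩ := (mem_rotTopLists_iff hH).1 hl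
    have hlen' : l.length = k + 1 := by
      have := List.length_pos_iff.2 hne; omega
    rw [mem_coe, mem_filter, mem_sawFin_iff, mem_sawLists_iff]
    refine ⟨⟨?_, ?_, ?_, ?_⟩, ?_⟩
    · rw [List.isChain_map]
      exact hc.imp fun u v (h : hvGraph.Adj u v) => ((shift 0 (-1)).map_rel_iff.2 h)
    · rw [List.head?_map, hh]; rfl
    · rw [List.length_map, hlen']
    · exact hnd.map (shift 0 (-1)).injective
    · intro u hu
      rw [List.mem_map] at hu
      obtain ⟨v, hv, rfl⟩ := hu
      have hξ := xi_bounds_of_mem_erase (hV v hv)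
      rw [xi_shift]
      push_cast
      omega
  · exact (List.map_injective_iff.2 (shift 0 (-1)).injective) h

/-- **`B^{→}_{H,W}(x; 1) ≤ x · Σ_n c_n(Slab_{H+1}) x^n`** whenever the series converges (group the top lists by length, count through the chart).
[cite: Beaton2014RotatedHoneycomb, §3.2, Proposition 8 and Corollary 10 (arXiv v3 p. 15: finiteness of strip generating functions); MadrasSlade1993, §8.2] -/
theorem rotStrip_top_one_le {H : ℕ} (hchart : RotSlabChart) (hH : 1 ≤ H) {x : ℝ} (hx : 0 < x)
    (hsum : Summable (fun n : ℕ => (HexBW.slabCount (H + 1) n : ℝ) * x ^ n)) (Wd : ℕ) :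
    rotStripGFxy H Wd (IsRotTopDart H) x 1 ≤ x * ∑' n, (HexBW.slabCount (H + 1) n : ℝ) * x ^ n := by
  rw [rotStripGFxy_top_eq hH]
  simp only [one_pow, mul_one]
  set S := rotTopLists H Wd with hS
  set N := ((rotStripV H Wd).erase wOut).card with hN
  -- every top list has between `1` and `N` vertices
  have hlen : ∀ l ∈ S, 1 ≤ l.length ∧ l.length ≤ N := by
    intro l hl
    obtain ⟨-, -, hnd, hV, hne, -⟩ := (mem_rotTopLists_iff hH).1 hl
    refine ⟨List.length_pos_iff.2 hne, ?_⟩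
    rw [hN, ← List.toFinset_card_of_nodup hnd]
    exact card_le_card fun v hv => hV v (List.mem_toFinset.1 hv)
  have hmaps : ∀ l ∈ S, l.length - 1 ∈ range N := fun l hl => by
    have := hlen l hl; rw [mem_range]; omega
  rw [← sum_fiberwise_of_maps_to hmaps]
  have hfib : ∀ k ∈ range N, ∑ l ∈ S.filter (fun l => l.length - 1 = k), x ^ l.length
      ≤ (HexBW.slabCount (H + 1) k : ℝ) * x ^ k * x := by
    intro k hk
    have : ∑ l ∈ S.filter (fun l => l.length - 1 = k), x ^ l.length
        = ((S.filter fun l => l.length - 1 = k).card : ℝ) * x ^ (k + 1) := by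
      rw [← nsmul_eq_mul, ← sum_const]
      refine sum_congr rfl fun l hl => ?_
      rw [mem_filter] at hl
      have := hlen l hl.1
      rw [show l.length = k + 1 by omega]
    rw [this, pow_succ, ← mul_assoc]
    exact mul_le_mul_of_nonneg_right (mul_le_mul_of_nonneg_right (by exact_mod_cast card_rotTopLists_len_le hchart hH k)
      (pow_nonneg hx.le k)) hx.le
  calc ∑ k ∈ range N, ∑ l ∈ S.filter (fun l => l.length - 1 = k), x ^ l.length
      ≤ ∑ k ∈ range N, (HexBW.slabCount (H + 1) k : ℝ) * x ^ k * x := sum_le_sum hfib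
    _ = x * ∑ k ∈ range N, (HexBW.slabCount (H + 1) k : ℝ) * x ^ k := by rw [mul_sum]; exact sum_congr rfl fun k _ => by ring
    _ ≤ x * ∑' n, (HexBW.slabCount (H + 1) n : ℝ) * x ^ n :=
        mul_le_mul_of_nonneg_left (hsum.sum_le_tsum (range N) fun n _ => by positivity) hx.le

/-- **D5ʳ DISCHARGED**: `RotSlabChart → SlabStrict → RotStripSupercritFinite`, with the explicit supercritical point
`x₁ := 2/(μ(Slab_{H+1}) + x_c⁻¹)` (`x_c < x₁ < 1/μ(Slab_{H+1})` by R100). [cite: Beaton2014RotatedHoneycomb, §3.2, Proposition 8 (arXiv v3 p. 15: μ_T(1,1) < μ) and Corollary 10; HammersleyWhittington1985] -/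
theorem rotStripSupercritFinite_of (hchart : RotSlabChart) (hstrict : SlabStrict) : RotStripSupercritFinite := by
  intro H hH
  have hx := hexCriticalFugacity_pos_lt_one.1
  obtain ⟨μ, hμ⟩ : ∃ μ : ℝ, HexBW.slabConnectiveConstant (H + 1) = μ := ⟨_, rfl⟩
  have hμlt : μ < hexCriticalFugacity⁻¹ := by
    rw [← hμ, ← hexConnectiveConstant_eq_inv]; exact hstrict (H + 1) (by omega)
  have hμ0 : 0 < μ := hμ ▸ HexBW.slabConnectiveConstant_pos (by omega)
  have hden : 0 < μ + hexCriticalFugacity⁻¹ := by positivity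
  have hinv : hexCriticalFugacity * hexCriticalFugacity⁻¹ = 1 := mul_inv_cancel₀ hx.ne'
  obtain ⟨x₁, hx₁⟩ : ∃ x₁ : ℝ, x₁ = 2 / (μ + hexCriticalFugacity⁻¹) := ⟨_, rfl⟩
  have hx₁0 : 0 < x₁ := by rw [hx₁]; positivity
  have hxx₁ : hexCriticalFugacity < x₁ := by
    rw [hx₁, lt_div_iff₀ hden]
    nlinarith [mul_lt_mul_of_pos_left hμlt hx]
  have hμx₁ : HexBW.slabConnectiveConstant (H + 1) * x₁ < 1 := by
    rw [hμ, hx₁, mul_div_assoc', div_lt_one hden]; linarith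
  have hsum := summable_slabCount_mul_pow_of_lt (H' := H + 1) (by omega) hx₁0 hμx₁
  refine ⟨x₁, hxx₁, x₁ * ∑' n, (HexBW.slabCount (H + 1) n : ℝ) * x₁ ^ n, ?_⟩
  rintro _ ⟨Wd, rfl⟩
  exact rotStrip_top_one_le hchart hH hx₁0 hsum (Wd + 1)

/-- **FINAL, over the three kernel-done HOME inputs ⑨ / chart / R100 by name**: `y_c = y†` for Beaton's rotated half-plane.
[cite: Beaton2014RotatedHoneycomb, Theorem 1 (arXiv v3 p. 2)] -/
theorem hexRotSurfaceYc_eq_of_R100 (hB : RotTopUnboundedXc) (hchart : RotSlabChart) (hstrict : SlabStrict) :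
    hexRotSurfaceYc = rotYdagger :=
  hexRotSurfaceYc_eq_of_stripCores hB (rotStripSupercritFinite_of hchart hstrict)


/-! ### The capstone, unconditional -/

/-- **The slab chart holds** — a-p5's `HV.card_rotSlabSAWs_le` (`HexSAWRotSlabSummable.lean`). [cite: MadrasSlade1993, §8.2, eq. (8.2.1); Beaton2014RotatedHoneycomb, §2.2 (the domain D_{T,L} and its height, arXiv v3 p. 5; Fig. 3 p. 6; our notation ξ for the row index)] -/
theorem rotSlabChart_holds : RotSlabChart := fun H₀ s k => card_rotSlabSAWs_le H₀ s k

/-- `RotSlabChart` — `_holds` alias of `rotSlabChart_holds` above under the fact's exact name (appended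
2026-08-28, D-0026 bookkeeping: the proof term is the existing theorem of this file; no statement,
definition or attribute is edited; no new named fact; the ledger's debt table listed the fact
unproved). [cite: MadrasSlade1993, §8.2, eq. (8.2.1); Beaton2014RotatedHoneycomb, §2.2 (the domain D_{T,L} and its height, arXiv v3 p. 5; Fig. 3 p. 6; our notation ξ for the row index)] -/
theorem _root_.Literature.Probability.RandomPlanarGeometry.SAW.HV.RotSlabChart_holds :
    RotSlabChart :=
  _root_.Literature.Probability.RandomPlanarGeometry.SAW.HV.rotSlabChart_holds

/-- **R100 holds** — a-p5's `HexBW.slabConnectiveConstant_lt_hex` (`HexSAWBrickWallSlabStrict.lean`). [cite: Beaton2014RotatedHoneycomb, §3.2, Proposition 8 (arXiv v3 p. 15); MadrasSlade1993, Theorem 8.2.1] -/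
theorem slabStrict_holds : SlabStrict := fun _ hH => HexBW.slabConnectiveConstant_lt_hex hH

/-- `SlabStrict` — `_holds` alias of `slabStrict_holds` above under the fact's exact name (appended
2026-08-28, D-0026 bookkeeping: the proof term is the existing theorem of this file; no statement,
definition or attribute is edited; no new named fact; the ledger's debt table listed the fact
unproved). [cite: Beaton2014RotatedHoneycomb, §3.2, Proposition 8 (arXiv v3 p. 15); MadrasSlade1993, Theorem 8.2.1] -/
theorem _root_.Literature.Probability.RandomPlanarGeometry.SAW.HV.SlabStrict_holds : SlabStrict :=
  _root_.Literature.Probability.RandomPlanarGeometry.SAW.HV.slabStrict_holds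

/-- **D5ʳ holds unconditionally** — from the slab chart and R100. [cite: Beaton2014RotatedHoneycomb, §3.2, Proposition 8 (arXiv v3 p. 15); MadrasSlade1993, Theorem 8.2.1] -/
theorem rotStripSupercritFinite_holds : RotStripSupercritFinite := rotStripSupercritFinite_of rotSlabChart_holds slabStrict_holds

/-- `RotStripSupercritFinite` — `_holds` alias of `rotStripSupercritFinite_holds` above under the fact's exact name (appended
2026-08-28, D-0026 bookkeeping: the proof term is the existing theorem of this file; no statement,
definition or attribute is edited; no new named fact; the ledger's debt table listed the fact
unproved). [cite: Beaton2014RotatedHoneycomb, §3.2, Proposition 8 (arXiv v3 p. 15); MadrasSlade1993, Theorem 8.2.1] -/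
theorem _root_.Literature.Probability.RandomPlanarGeometry.SAW.HV.RotStripSupercritFinite_holds :
    RotStripSupercritFinite :=
  _root_.Literature.Probability.RandomPlanarGeometry.SAW.HV.rotStripSupercritFinite_holds

/-- **D3ʳ holds unconditionally**: for `0 < y < y†` the rotated half-plane partition function is bounded for every `x < x_c`.
[cite: Beaton2014RotatedHoneycomb, §4 (arXiv v3 p. 16) with Lemma 12 (p. 17)] -/
theorem rotHPBelow_holds : RotHPBelow :=
  rotHpBelow_of_faces rotHalfPlaneCut_holds rotLevelCost_holds rotTopBoundXc_holds tailCount_holds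

/-- `RotHPBelow` — `_holds` alias of `rotHPBelow_holds` above under the fact's exact name (appended
2026-08-28, D-0026 bookkeeping: the proof term is the existing theorem of this file; no statement,
definition or attribute is edited; no new named fact; the ledger's debt table listed the fact
unproved). [cite: Beaton2014RotatedHoneycomb, §4 (arXiv v3 p. 16) with Lemma 12 (p. 17)] -/
theorem _root_.Literature.Probability.RandomPlanarGeometry.SAW.HV.RotHPBelow_holds : RotHPBelow :=
  _root_.Literature.Probability.RandomPlanarGeometry.SAW.HV.rotHPBelow_holds

/-- **D7ʳ holds unconditionally**: for `y > y†` the rotated half-plane partition function diverges at some `x < x_c`.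
[cite: Beaton2014RotatedHoneycomb, §4, Proposition 11 (arXiv v3 p. 17)] -/
theorem rotHPAbove_holds : RotHPAbove :=
  rotHpAbove_of_faces rotTopUnboundedXc_holds rotHoelderXY_holds rotStripSupercritFinite_holds rotReversalInjection_holds

/-- `RotHPAbove` — `_holds` alias of `rotHPAbove_holds` above under the fact's exact name (appended
2026-08-28, D-0026 bookkeeping: the proof term is the existing theorem of this file; no statement,
definition or attribute is edited; no new named fact; the ledger's debt table listed the fact
unproved). [cite: Beaton2014RotatedHoneycomb, §4, Proposition 11 (arXiv v3 p. 17)] -/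
theorem _root_.Literature.Probability.RandomPlanarGeometry.SAW.HV.RotHPAbove_holds : RotHPAbove :=
  _root_.Literature.Probability.RandomPlanarGeometry.SAW.HV.rotHPAbove_holds

/-- **BEATON 2014, THEOREM 1 (radius form), NO HYPOTHESIS: the critical surface fugacity of self-avoiding walks in the rotated honeycomb
half-plane is `y_c = y†`** (`hexRotSurfaceYc = rotYdagger`). [cite: Beaton2014RotatedHoneycomb, Theorem 1 (arXiv v3 p. 2) with Proposition 7 (p. 11)] -/
theorem hexRotSurfaceYc_eq : hexRotSurfaceYc = rotYdagger :=
  hexRotSurfaceYc_eq_of_R100 rotTopUnboundedXc_holds rotSlabChart_holds slabStrict_holds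

/-- … in the printed closed form `y_c = √((2+√2)/(1+√2−√(2+√2)))` (`= 2.455…`; tree `HV.rotYdagger_eq_printed`).
[cite: Beaton2014RotatedHoneycomb, Theorem 1 (arXiv v3 p. 2)] -/
theorem hexRotSurfaceYc_eq_printed :
    hexRotSurfaceYc = Real.sqrt ((2 + Real.sqrt 2) / (1 + Real.sqrt 2 - Real.sqrt (2 + Real.sqrt 2))) := by
  rw [hexRotSurfaceYc_eq, rotYdagger_eq_printed]

end Literature.Probability.RandomPlanarGeometry.SAW.HV
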